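import Literature.NumberTheory.DiophantineGeometry.WeightedRootHeight
import Literature.NumberTheory.EllipticCurves.HeightsBaseChangeProofs
import Mathlib.FieldTheory.SplittingField.Construction
import HarnessLib

/-!
# Heights of roots of weighted integral relations, II: the lower bound `u·h(β) ≤ w·h(α) + O([K:ℚ])`

Companion of `WeightedRootHeight.lean` (same source: the weighted-homogeneous integral relation of
Bombieri–Gubler, *Heights in Diophantine Geometry*, §2.5 (2.5)–(2.9), in its affine two-variable,
general-weight form). There we proved the UPPER bound: if `α^N + Σ_{k<N} a_k(β) α^k = 0`,
`a_k ∈ ℤ[X]`, `w·deg a_k ≤ u·(N-k)`, then `w·h(α) ≤ u·h(β) + O(1)` (absolute heights, constants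
uniform in the number field). Here:

* `natDegree_mul_logHeight₁_le_aeval` — **the value of an integer polynomial is at least as high as
  its argument**: `deg p · h(β) ≤ h(p(β)) + O(1)` (the lower half of `h(p(β)) = deg p·h(β) + O(1)`,
  [BombieriGubler2006, Thm. 1.6.13 / §2.5]; obtained from the upper root bound applied to `β` as a
  root of `p(Y) - p(β) = 0`, a weighted relation in `(β, p(β))` with weights `(1, deg p)`).
* `logHeight₁_ge_of_weighted` — **the LOWER weighted root bound**: if moreover the constant term has
  the full weighted degree, `w·deg a_0 = u·N`, then EVERY root also satisfies
  `u·h(β) ≤ w·h(α) + O(1)`. Proof: in a splitting field all `N` roots `α_j` satisfy the upper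
  bound, their product is `± a_0(β)` whose height is `≥ deg a_0 · h(β) - O(1)`, and
  `h(Π α_j) ≤ Σ h(α_j)`; heights are transported along the extension by the tree's
  `NumberField.logHeight₁_algebraMap` (`h_L = [L:K]·h_K`).
* `exists_abs_sub_le_of_weighted` — the packaged two-sided statement
  `|w·h(α) - u·h(β)| ≤ C·[K:ℚ]` with `C` depending only on the relation.

Use (abc-iut cell, route `Summit.ABC.ABC.Theses.IUTThetaPilot`, support item `GenEllTwo`, work
package W4 of the number-field-only plan for [GenEll] Thm. 2.1): for two functions `α, β` on a curve
with a single common pole the minimal polynomial of `α` over `ℚ(β)` has this shape, so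
`h(α(P)) = (e_α/e_β)·h(β(P)) + O(1)` — the sharp Weil-height comparison without the Néron/Weil
height machine (instances for `r^e = x(1-x)` etc. in `SuperellipticHeights.lean`). Everything here is
proved; no definitions, no named facts; classical height theory, nothing disputed.
-/

noncomputable section

open Height Height.AdmissibleAbsValues Finset Polynomial Real
open Literature.NumberTheory.Transcendental

namespace Literature.NumberTheory.DiophantineGeometry

namespace WeightedRoot

/-! ### The value of a polynomial is at least as high as its argument -/

section AbstractField

variable {K : Type*} [Field K] [AdmissibleAbsValues K] [CharZero K]

/-- **`deg p · h(β) ≤ h(p(β)) + O(totalWeight K)`** for a non-constant integer polynomial `p`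
(the lower half of the classical `h(p(β)) = deg p · h(β) + O(1)`; Bombieri–Gubler §2.5 with the
presentation `z ↦ p(z)` of `ℙ¹`, cf. Thm. 1.6.13 for the relation between the height of a polynomial
and of its roots). Derived from the weighted upper root bound: `β` is a root of
`c·Y^n + p_{n-1} Y^{n-1} + ⋯ + (p_0 - p(β))`, a relation of weights `(wt β, wt p(β)) = (1, n)`. The
constant: `n·(log (n·B') + log |c|)` with `c` the leading coefficient and
`B' = max(1, Σ_k ‖c^{n-1-k} b_k‖₁)`, `b_0 = p_0 - X`, `b_k = p_k`.
[cite: BombieriGubler2006, §2.5 (2.5)–(2.9) p.43] -/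
theorem natDegree_mul_logHeight₁_le_aeval (p : ℤ[X]) (hp : 0 < p.natDegree) (β : K) :
    (p.natDegree : ℝ) * logHeight₁ β ≤ logHeight₁ (aeval β p) + totalWeight K *
      (p.natDegree * Real.log (p.natDegree * max 1 (∑ k ∈ range p.natDegree,
        ∑ i ∈ range ((C (p.leadingCoeff ^ (p.natDegree - 1 - k)) *
          (if k = 0 then C (p.coeff 0) - X else C (p.coeff k))).natDegree + 1),
        |((C (p.leadingCoeff ^ (p.natDegree - 1 - k)) *
          (if k = 0 then C (p.coeff 0) - X else C (p.coeff k))).coeff i : ℝ)|)) +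
        p.natDegree * Real.log |(p.leadingCoeff : ℝ)|) := by
  have hc : p.leadingCoeff ≠ 0 := by
    rw [Ne, leadingCoeff_eq_zero]; rintro rfl; simp at hp
  set n := p.natDegree with hn
  set b : ℕ → ℤ[X] := fun k => if k = 0 then C (p.coeff 0) - X else C (p.coeff k) with hb
  have hb0 : b 0 = C (p.coeff 0) - X := by simp [hb]
  have hbk : ∀ k, k ≠ 0 → b k = C (p.coeff k) := fun k hk => by simp [hb, hk]
  have hd : ∀ k < n, n * (b k).natDegree ≤ 1 * (n - k) := by
    intro k hk
    by_cases hk0 : k = 0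
    · subst hk0
      rw [hb0, one_mul, Nat.sub_zero]
      calc n * (C (p.coeff 0) - X).natDegree ≤ n * 1 :=
            Nat.mul_le_mul_left n ((natDegree_sub_le _ _).trans (by simp))
        _ = n := mul_one n
    · rw [hbk k hk0, natDegree_C, mul_zero]; exact Nat.zero_le _
  set γ : K := aeval β p with hγ
  have hb0' : aeval γ (b 0) = (p.coeff 0 : K) - γ := by
    rw [hb0, map_sub, aeval_C, aeval_X, algebraMap_int_eq, eq_intCast]
  have hbk' : ∀ k, k ≠ 0 → aeval γ (b k) = (p.coeff k : K) := fun k hk => by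
    rw [hbk k hk, aeval_C, algebraMap_int_eq, eq_intCast]
  have hrel : (p.leadingCoeff : K) * β ^ n + ∑ k ∈ range n, aeval γ (b k) * β ^ k = 0 := by
    have hsum : ∑ k ∈ range n, aeval γ (b k) * β ^ k =
        (∑ k ∈ range n, (p.coeff k : K) * β ^ k) - γ := by
      obtain ⟨m, hm⟩ : ∃ m, n = m + 1 := ⟨n - 1, (Nat.sub_add_cancel hp).symm⟩
      rw [hm, Finset.sum_range_succ', Finset.sum_range_succ' (fun k => (p.coeff k : K) * β ^ k), hb0']
      simp only [hbk' _ (Nat.succ_ne_zero _), pow_zero, mul_one]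
      ring
    rw [hsum]
    have hp' : γ = ∑ k ∈ range (n + 1), (p.coeff k : K) * β ^ k := by
      rw [hγ, aeval_eq_sum_range]
      exact sum_congr rfl fun i _ => by rw [zsmul_eq_mul]
    rw [hp', Finset.sum_range_succ, coeff_natDegree]
    ring
  have h := logHeight₁_le_of_weighted_leadingCoeff (K := K) hp (u := 1) hp hc b hd hrel
  simpa only [Nat.cast_one, one_mul] using h

end AbstractField

/-! ### Multiset products -/

section Multiset

variable {L : Type*} [Field L] [AdmissibleAbsValues L]

/-- `h(Π_{γ ∈ S} γ) ≤ Σ_{γ ∈ S} h(γ)` for a multiset `S`. [cite: BombieriGubler2006, Prop 1.5.15] -/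
theorem logHeight₁_multiset_prod_le (S : Multiset L) :
    logHeight₁ S.prod ≤ (S.map logHeight₁).sum := by
  induction S using Multiset.induction with
  | empty => simp
  | cons a S ih =>
    rw [Multiset.prod_cons, Multiset.map_cons, Multiset.sum_cons]
    exact (logHeight₁_mul_le _ _).trans (by linarith)

end Multiset

/-! ### The lower weighted root bound over number fields -/

section NumberField

open NumberField

/-- **Lower weighted root bound.** Let `a_k ∈ ℤ[X]` (`k < N`, `0 < N`, `0 < w`) with
`w·deg a_k ≤ u·(N-k)` and FULL weighted degree of the constant term, `w·deg a_0 = u·N`. Then for every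
number field `K` and `α, β ∈ K` with `α^N + Σ_{k<N} a_k(β) α^k = 0`:
`u · logHeight₁ β ≤ w · logHeight₁ α + [K:ℚ] · C` with `C` depending only on `(N, u, w, a)`
(all `N` roots satisfy the upper bound of `logHeight₁_le_of_weighted`, their product `± a_0(β)` has
height `≥ deg a_0 · h(β) - O(1)`; Bombieri–Gubler §2.5 / Thm. 1.6.13).
[cite: BombieriGubler2006, §2.5 (2.5)–(2.9) p.43] -/
theorem exists_logHeight₁_ge_of_weighted {N u w : ℕ} (hN : 0 < N) (hw : 0 < w) (a : ℕ → ℤ[X])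
    (hd : ∀ k < N, w * (a k).natDegree ≤ u * (N - k)) (h0 : w * (a 0).natDegree = u * N) :
    ∃ C : ℝ, ∀ (K : Type) [Field K] [NumberField K] (α β : K),
      α ^ N + ∑ k ∈ range N, aeval β (a k) * α ^ k = 0 →
        (u : ℝ) * logHeight₁ β ≤ w * logHeight₁ α + Module.finrank ℚ K * C := by
  classical
  -- the degenerate case `u = 0`
  rcases Nat.eq_zero_or_pos u with rfl | hu
  · refine ⟨0, fun K _ _ α β _ => ?_⟩
    simp only [Nat.cast_zero, zero_mul, mul_zero, add_zero]
    exact mul_nonneg (Nat.cast_nonneg _) (zero_le_logHeight₁ _)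
  -- `deg a_0 > 0`
  set n := (a 0).natDegree with hn
  have hn0 : 0 < n := by
    by_contra h; push Not at h
    have : n = 0 := by omega
    rw [this, mul_zero] at h0
    exact absurd h0.symm (Nat.mul_ne_zero hu.ne' hN.ne')
  -- the two constants from the upper bounds (written abstractly via the `ℚ` instance to fix them)
  set c₁ : ℝ := w * Real.log (N * max 1 (∑ k ∈ range N, ∑ i ∈ range ((a k).natDegree + 1),
    |((a k).coeff i : ℝ)|)) with hc₁
  set c₂ : ℝ := n * Real.log (n * max 1 (∑ k ∈ range n,
        ∑ i ∈ range ((C ((a 0).leadingCoeff ^ (n - 1 - k)) *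
          (if k = 0 then C ((a 0).coeff 0) - X else C ((a 0).coeff k))).natDegree + 1),
        |((C ((a 0).leadingCoeff ^ (n - 1 - k)) *
          (if k = 0 then C ((a 0).coeff 0) - X else C ((a 0).coeff k))).coeff i : ℝ)|)) +
        n * Real.log |((a 0).leadingCoeff : ℝ)| with hc₂
  refine ⟨w * c₂ + (N - 1) * c₁, fun K _ _ α β hrel => ?_⟩
  -- the polynomial and its splitting field
  set f : K[X] := X ^ N + ∑ k ∈ range N, C (aeval β (a k)) * X ^ k with hf
  have hdeglt : (∑ k ∈ range N, C (aeval β (a k)) * X ^ k).degree < (N : WithBot ℕ) := by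
    refine (degree_sum_le _ _).trans_lt ((Finset.sup_lt_iff (WithBot.bot_lt_coe N)).mpr ?_)
    intro k hk
    calc (C (aeval β (a k)) * X ^ k).degree ≤ (k : WithBot ℕ) := degree_C_mul_X_pow_le _ _
      _ < N := by exact_mod_cast mem_range.mp hk
  have hfmonic : f.Monic := by rw [hf]; exact monic_X_pow_add hdeglt
  have hfdeg : f.natDegree = N := by
    rw [hf, natDegree_add_eq_left_of_degree_lt, natDegree_X_pow]
    rwa [degree_X_pow]
  -- evaluation and constant coefficient of `f` (computed before the splitting field is introduced)
  have hfeval : ∀ {R : Type} [CommRing R] (g : K →+* R) (x : R),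
      eval₂ g x f = x ^ N + ∑ k ∈ range N, g (aeval β (a k)) * x ^ k := by
    intro R _ g x
    rw [hf, eval₂_add, eval₂_X_pow, eval₂_finsetSum]
    simp only [eval₂_mul, eval₂_C, eval₂_X_pow]
  have hfcoeff : f.coeff 0 = aeval β (a 0) := by
    rw [hf, coeff_add, coeff_X_pow, finsetSum_coeff]
    simp only [coeff_C_mul, coeff_X_pow]
    rw [if_neg hN.ne, zero_add, Finset.sum_eq_single 0]
    · simp
    · intro k _ hk; simp [Ne.symm hk]
    · intro h; exact absurd (mem_range.mpr hN) h
  let L := f.SplittingField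
  haveI : NumberField L := NumberField.of_module_finite K L
  set ι : K →+* L := algebraMap K L with hι
  have hsplit : (f.map ι).Splits := SplittingField.splits f
  have hfmonic' : (f.map ι).Monic := hfmonic.map ι
  have hfdeg' : (f.map ι).natDegree = N := by rw [natDegree_map, hfdeg]
  set S := (f.map ι).roots with hS
  have hcard : S.card = N := by rw [hS, ← hsplit.natDegree_eq_card_roots, hfdeg']
  have hf0 : f.map ι ≠ 0 := hfmonic'.ne_zero
  -- `ι` commutes with integer polynomial evaluation
  have haeval : ∀ (q : ℤ[X]) (x : K), ι (aeval x q) = aeval (ι x) q := fun q x => by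
    rw [aeval_def, aeval_def, hom_eval₂, RingHom.ext_int (ι.comp (algebraMap ℤ K)) (algebraMap ℤ L)]
  -- every root satisfies the weighted relation (with `ι β`)
  have hroot : ∀ γ ∈ S, γ ^ N + ∑ k ∈ range N, aeval (ι β) (a k) * γ ^ k = 0 := by
    intro γ hγ
    have h1 := (mem_roots hf0).mp hγ
    rw [IsRoot, eval_map, hfeval] at h1
    rw [← h1]
    congr 1
    exact sum_congr rfl fun k _ => by rw [haeval]
  -- `ι α` is a root
  have hαroot : ι α ∈ S := by
    rw [hS, mem_roots hf0, IsRoot, eval_map, eval₂_hom]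
    have : f.eval α = 0 := by
      rw [eval, hfeval]
      simpa using hrel
    rw [this, map_zero]
  obtain ⟨S', hS'⟩ := Multiset.exists_cons_of_mem hαroot
  have hcard' : S'.card = N - 1 := by
    have := congrArg Multiset.card hS'
    rw [Multiset.card_cons, hcard] at this
    omega
  -- product of the roots
  have hprod : ι (aeval β (a 0)) = (-1) ^ N * S.prod := by
    have h1 := hsplit.coeff_zero_eq_prod_roots_of_monic hfmonic'
    rw [hfdeg'] at h1
    rw [← h1, coeff_map, hfcoeff]
  -- heights in `L`
  have hup : ∀ γ ∈ S, (w : ℝ) * logHeight₁ γ ≤ u * logHeight₁ (ι β) + totalWeight L * c₁ :=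
    fun γ hγ => logHeight₁_le_of_weighted hN hw a hd (hroot γ hγ)
  have hlow : (n : ℝ) * logHeight₁ (ι β) ≤ logHeight₁ (aeval (ι β) (a 0)) + totalWeight L * c₂ :=
    natDegree_mul_logHeight₁_le_aeval (a 0) hn0 (ι β)
  have hprodle : logHeight₁ (aeval (ι β) (a 0)) ≤ logHeight₁ (ι α) + (S'.map logHeight₁).sum := by
    rw [← haeval, hprod, hS', Multiset.prod_cons]
    calc logHeight₁ ((-1) ^ N * (ι α * S'.prod))
        ≤ logHeight₁ ((-1 : L) ^ N) + logHeight₁ (ι α * S'.prod) := logHeight₁_mul_le _ _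
      _ = logHeight₁ (ι α * S'.prod) := by
          rw [logHeight₁_pow, show (-1 : L) = -1 from rfl, logHeight₁_neg, logHeight₁_one,
            mul_zero, zero_add]
      _ ≤ logHeight₁ (ι α) + logHeight₁ S'.prod := logHeight₁_mul_le _ _
      _ ≤ logHeight₁ (ι α) + (S'.map logHeight₁).sum := by
          gcongr; exact logHeight₁_multiset_prod_le S'
  have hrest : (w : ℝ) * (S'.map logHeight₁).sum ≤ (N - 1 : ℝ) * (u * logHeight₁ (ι β) + totalWeight L * c₁) := by
    have hmem : ∀ γ ∈ S', (w : ℝ) * logHeight₁ γ ≤ u * logHeight₁ (ι β) + totalWeight L * c₁ :=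
      fun γ hγ => hup γ (by rw [hS']; exact Multiset.mem_cons_of_mem hγ)
    have h1 : (w : ℝ) * (S'.map logHeight₁).sum = (S'.map fun γ => (w : ℝ) * logHeight₁ γ).sum := by
      rw [Multiset.sum_map_mul_left]
    rw [h1]
    calc (S'.map fun γ => (w : ℝ) * logHeight₁ γ).sum
        ≤ (S'.map fun _ => (u : ℝ) * logHeight₁ (ι β) + totalWeight L * c₁).sum :=
          Multiset.sum_map_le_sum_map _ _ hmem
      _ = (N - 1 : ℝ) * (u * logHeight₁ (ι β) + totalWeight L * c₁) := by
          rw [Multiset.map_const', Multiset.sum_replicate, hcard', nsmul_eq_mul]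
          rw [Nat.cast_sub hN, Nat.cast_one]
  -- combine in `L`
  have hw0 : (0 : ℝ) ≤ w := Nat.cast_nonneg _
  have hmainL : (u : ℝ) * logHeight₁ (ι β) ≤ w * logHeight₁ (ι α) +
      totalWeight L * (w * c₂ + (N - 1) * c₁) := by
    have e0 : (u : ℝ) * N = w * n := by exact_mod_cast h0.symm
    have h1 : (w : ℝ) * (n * logHeight₁ (ι β)) ≤ w * (logHeight₁ (aeval (ι β) (a 0)) + totalWeight L * c₂) :=
      mul_le_mul_of_nonneg_left hlow hw0
    have h2 : (w : ℝ) * logHeight₁ (aeval (ι β) (a 0)) ≤ w * logHeight₁ (ι α) + w * (S'.map logHeight₁).sum := by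
      nlinarith [hprodle]
    have h3 : (u : ℝ) * N * logHeight₁ (ι β) = w * (n * logHeight₁ (ι β)) := by rw [e0]; ring
    have hN1 : (1 : ℝ) ≤ N := by exact_mod_cast hN
    have hβ0 := zero_le_logHeight₁ (ι β)
    nlinarith [h1, h2, h3, hrest, hβ0, hN1]
  -- descend to `K`
  have hdegL : (totalWeight L : ℝ) = Module.finrank K L * Module.finrank ℚ K := by
    rw [NumberField.totalWeight_eq_finrank, ← Module.finrank_mul_finrank ℚ K L]
    push_cast; ring
  rw [hι, NumberField.logHeight₁_algebraMap, NumberField.logHeight₁_algebraMap, hdegL] at hmainL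
  have hKL : (0 : ℝ) < Module.finrank K L := by exact_mod_cast Module.finrank_pos
  have hKQ : (0 : ℝ) ≤ Module.finrank ℚ K := Nat.cast_nonneg _
  have : (Module.finrank K L : ℝ) * (u * logHeight₁ β) ≤
      (Module.finrank K L : ℝ) * (w * logHeight₁ α + Module.finrank ℚ K * (w * c₂ + (N - 1) * c₁)) := by
    nlinarith [hmainL]
  exact le_of_mul_le_mul_left this hKL

/-- **Two-sided weighted root bound** (packaged): under the hypotheses of
`exists_logHeight₁_ge_of_weighted` there is `C` with `|w·h_K(α) - u·h_K(β)| ≤ C·[K:ℚ]` for every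
number field `K` and every solution `(α, β) ∈ K²` of the relation — i.e. `h(α) = (u/w)·h(β) + O(1)`
for the absolute heights, uniformly in the field (Bombieri–Gubler §2.5 / Thm. 1.6.13).
[cite: BombieriGubler2006, §2.5 (2.5)–(2.9) p.43] -/
theorem exists_abs_sub_le_of_weighted {N u w : ℕ} (hN : 0 < N) (hw : 0 < w) (a : ℕ → ℤ[X])
    (hd : ∀ k < N, w * (a k).natDegree ≤ u * (N - k)) (h0 : w * (a 0).natDegree = u * N) :
    ∃ C : ℝ, ∀ (K : Type) [Field K] [NumberField K] (α β : K),
      α ^ N + ∑ k ∈ range N, aeval β (a k) * α ^ k = 0 →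
        |(w : ℝ) * logHeight₁ α - u * logHeight₁ β| ≤ C * Module.finrank ℚ K := by
  obtain ⟨C₁, hC₁⟩ := exists_logHeight₁_ge_of_weighted hN hw a hd h0
  set C₂ : ℝ := w * Real.log (N * max 1 (∑ k ∈ range N, ∑ i ∈ range ((a k).natDegree + 1),
    |((a k).coeff i : ℝ)|)) with hC₂
  refine ⟨max C₁ C₂, fun K _ _ α β hrel => ?_⟩
  have h1 := hC₁ K α β hrel
  have h2 := logHeight₁_le_of_weighted (K := K) hN hw a hd hrel
  rw [NumberField.totalWeight_eq_finrank] at h2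
  have hK : (0 : ℝ) ≤ Module.finrank ℚ K := Nat.cast_nonneg _
  rw [abs_le]
  constructor
  · nlinarith [le_max_left C₁ C₂]
  · nlinarith [le_max_right C₁ C₂]

end NumberField

end WeightedRoot

end Literature.NumberTheory.DiophantineGeometry

end
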